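import Summits.BirchSwinnertonDyer.Rank1Residual.X12.O11.RamifiedStrictDescent
import Literature.NumberTheory.EllipticCurves.BurungaleKobayashiNakamuraOta2026.AnticyclotomicEllipticUnitClass
import HarnessLib

/-!
# O11 (CM, analytic rank one, the RAMIFIED prime `p = |d_K| ≥ 5`): the elliptic-unit MECHANISM behind
# (R-EU), typed RELATIVE to the anticyclotomic elliptic-unit class datum — (R-IMC)∃, (R-PR)|IMC, and
# the PROVED seams (cell `bsd-cm`, planner D102/D110/D112 STEP A″ re-typed after bsd-cm-ram g7's β module and
# junk analysis `BETA-DESIGN-ram-g7.md` §2–§3; seat `bsd-cm-k7r-c4` g4; NOTHING asserted)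

HONEST FRAMING. `RamifiedStrictDescent.lean` types (R-EU) `RamifiedCMEllipticUnitIndexAt W p` as the
VALUATION IDENTITY (★_an) `n₀ + log_p #X[T] = n + n' + ord_p #Ш_an(W) + ord_p #Ш_an(W')` on the strict
anticyclotomic Selmer dual `X`; its elliptic-unit content ([BKNO] Thm. 3.14 (3): the left side is
`ord_π 𝔠`, `𝔠` the index of the BOTTOM class `z(𝟙)` of the Λ-adic elliptic-unit class) lived only in
docstrings. The Literature module `BurungaleKobayashiNakamuraOta2026/AnticyclotomicEllipticUnitClass.lean`
(bsd-cm-ram, p441800) now provides the carrier: the datum `D : EllipticUnitClassData W p K 𝔭 κ γ ι φ Ω 𝓔`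
([BKNO] §3.3.1 class over the dual-exponential datum `𝓔`, period `Ω`, Hecke character `φ`, embedding
datum `ι`) and its RELATIVE bottom index exponent `D.HasBottomIndexExp c` (`p^c = [S_{p,rel}(E/K) :
tors + 𝒪_K·z(𝟙)]`), unique relative to `𝓔` (`hasBottomIndexExp_iff`, `hasBottomIndexExp_unique`).
ram's junk analysis (§2: `scaleByP` moves `c` by `2` under `(𝓔, z) ↦ (p⁻¹𝓔, p·z)`) shows that NO CLOSED
carrier and NO `∀ (𝓔, D)`-law mentioning `c` alone can be junk-free; the junk-free pattern (§3) is
RELATIVE with SHARED binders. Accordingly this module types: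

* `RamifiedCMBottomClassExistsAt W p` — `@[conjecture]` (nothing asserted): at every analytic-rank-one
  O11 frame some datum `(ι, φ, Ω, 𝓔, D)` has a bottom index exponent (existence; ⟸ the existence claim
  `RubinEllipticUnitClasses` + non-vanishing of `z(𝟙)` in rank one, [BKNO] Prop. 3.7; cite-level).
* `RamifiedCMEllipticUnitIMCAt W p` — `@[conjecture]` (nothing asserted): **(R-IMC)∃** — at every such
  frame SOME datum has a bottom index exponent `c` satisfying the MAIN-CONJECTURE VALUATION IDENTITY
  `n₀ + log_p #X[T] = c` ([BKNO] Thm. 3.14 (3) ⇐ Rubin 1991 Thm. 4.1 + JLK 2011 + descent, read at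
  `T = 0`; holds for the genuine, integrally normalised class — the route's cite-level SUPPORT). In
  ∃-form the junk pairs cannot refute it (they only add witnesses); it implies `…ExistsAt`.
* `RamifiedCMBottomClassIndexLawAt W p` — `@[conjecture]` (nothing asserted): **(R-PR)|IMC — Perrin-Riou's
  law for the bottom class at the RAMIFIED prime, RELATIVE to the IMC identity**: for EVERY datum `D` and
  exponent `c` with `D.HasBottomIndexExp c` AND `n₀ + log_p #X[T] = c` (shared binder `c`, ram §3), the
  value law `c = n + n' + ord_p #Ш_an(W) + ord_p #Ш_an(W')` holds. Junk data (for which the IMC identity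
  fails) satisfy it vacuously; on the genuine datum it is exactly (★_an) = [BKNO] §1.4's deferred formula.
  The route's ATTACKED crux; OPEN; NOT in print.
* `ramifiedCMEllipticUnitIndexAt_of_imc_of_indexLaw` — PROVED: (R-IMC)∃ ∧ (R-PR)|IMC ⟹ (R-EU);
  `ramifiedCMBottomClassIndexLawAt_of_indexAt` — PROVED: (R-EU) ∧ (R-tors) ⟹ (R-PR)|IMC (no IMC piece
  needed in this direction: the relocation does not weaken the attacked statement);
  `ramifiedCMBottomClassExistsAt_of_imcAt` — PROVED: (R-IMC)∃ ⟹ existence.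

Companions (seat k7r-c4 g4): `Theorems/RamifiedSevenEllipticUnitsStrictControlAnyPrime.lean` ((R-ctrl)
a theorem, (R-tors) ⟸ GZK at every frame), `…IndexIffBsdpAnyPrime.lean` ((R-EU)@p ⟺ BSD_p(W) at every
CM-ramified prime). Nothing is asserted; no named fact is minted; O11, (R-EU) and the leaf stay OPEN.
References: [BKNO] arXiv:2608.06879 (2026) §3.3.1, Prop. 3.7, Thm. 3.14 (3), Prop. 4.10, Thm. 7.2, §1.4
[BurungaleKobayashiNakamuraOta2026]; K. Rubin, Invent. Math. 103 (1991) Thm. 4.1 [Rubin1991MainConj];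
B. Perrin-Riou, Ann. Inst. Fourier 43 (1993) §3.3; R. Greenberg, LNM 1716 §4 Lemma 4.2 [GreenbergLNM1716];
cell memo `pub/bsd-cm/bsd-cm-ram/queue-g7/BETA-DESIGN-ram-g7.md` §2–§3 (junk analysis, relative pattern).
-/

noncomputable section

open scoped Classical

open WeierstrassCurve NumberField IsDedekindDomain Field PowerSeries
  Literature.NumberTheory.EllipticCurves
  Literature.NumberTheory.EllipticCurves.Rank1Residual
  Literature.NumberTheory.EllipticCurves.Rank1Residual.Typed
  Literature.NumberTheory.EllipticCurves.Castella2018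
  Literature.NumberTheory.EllipticCurves.BurungaleKobayashiNakamuraOta2026
  Literature.NumberTheory.GaloisRepresentations
  Summit.BirchSwinnertonDyer.Rank1Residual.Additive

namespace Summit.BirchSwinnertonDyer.Rank1Residual.X12.O11

variable (W : WeierstrassCurve ℚ) [W.IsElliptic] [W.IsGloballyMinimal] (p : ℕ) [Fact p.Prime]

section EllipticUnitMechanism

/-- **CONSTRUCTION CLAIM TYPED (nothing asserted): at a framed O11 pair of analytic rank one, for every
anticyclotomic `ℤ_p`-tower with a topological generator, SOME anticyclotomic elliptic-unit class datum
`(ι, φ, Ω, 𝓔, D)` has a bottom index exponent `c`** (`D.HasBottomIndexExp c`: the index of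
`tors + 𝒪_K·z(𝟙)` in the bottom relaxed compact Selmer group is `p^c` — finite, i.e. `z(𝟙)` is
non-torsion and the module has `𝒪_𝔭`-rank one). Cite-level: [BKNO] §3.3.1 (3.8)–(3.9) (existence, the
tree's claim `RubinEllipticUnitClasses`) + Prop. 3.7 (1) / the explicit reciprocity law (non-vanishing
of `z(𝟙)` in analytic rank one). PREPRINT, shape only. OPEN; nothing booked.
[cite: BurungaleKobayashiNakamuraOta2026, §3.3.1 (3.8)–(3.9) and Prop. 3.7 (arXiv:2608.06879 pp. 19–20) (claim; preprint; shape only)] -/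
@[conjecture] def RamifiedCMBottomClassExistsAt : Prop :=
  ∀ (K : Type) [Field K] [NumberField K] (𝔭 : HeightOneSpectrum (𝓞 K))
    (W' : WeierstrassCurve ℚ) [W'.IsElliptic] [W'.IsGloballyMinimal] (C : VariableChange ℚ),
    IsFrame W p K 𝔭 W' C → W.analyticRank = 1 →
    ∀ (κ : ZpExtension K p), κ.IsAnticyclotomic →
      ∀ (γ : absoluteGaloisGroup K) [Fact (κ.IsTopGenerator γ)],
        ∃ (ι : PadicAlgCl p ≃+* ℂ) (φ : HeckeCharacter K) (Ω : ℂ) (𝓔 : AcDualExpSystem W p K 𝔭 κ ι)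
          (D : EllipticUnitClassData W p K 𝔭 κ γ ι φ Ω 𝓔) (c : ℕ), D.HasBottomIndexExp c

/-- **(R-IMC)∃ TYPED (nothing asserted): the elliptic-unit MAIN-CONJECTURE VALUATION IDENTITY at a
CM-ramified prime in analytic rank one, in junk-free existential form.** At every framed pair and every
anticyclotomic tower with generator, SOME datum `(ι, φ, Ω, 𝓔, D)` has a bottom index exponent `c` such
that, whenever the strict anticyclotomic Selmer dual `X` has `ord_p f(0) = n₀` and finite `X[T]`,
`n₀ + log_p #X[T] = c`. SOURCE: [BKNO] Thm. 3.14 (3) (`Ch_Λ(X_str) = Ch_Λ(𝒮_rel/Λ·z^ac)` ⇐ Rubin 1991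
Thm. 4.1 + Johnson-Leung–Kings 2011 Thm. 5.2 + descent) read at `T = 0` through the Euler
characteristic and exact bottom control — for the GENUINE, integrally normalised class; the rescaled
(junk) data of ram's `scaleByP` cannot refute an existential statement. The route's cite-level SUPPORT
piece; preprint + the cell's derivation, never a Literature fact while unrefereed. Nothing booked.
[cite: BurungaleKobayashiNakamuraOta2026, Thm. 3.14 (3) (arXiv:2608.06879 pp. 22–24) (claim; preprint; shape only)]
[cite: GreenbergLNM1716, §4 Lemma 4.2 (p. 102) (Euler characteristic; shape only)] -/
@[conjecture] def RamifiedCMEllipticUnitIMCAt : Prop :=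
  ∀ (K : Type) [Field K] [NumberField K] (𝔭 : HeightOneSpectrum (𝓞 K))
    (W' : WeierstrassCurve ℚ) [W'.IsElliptic] [W'.IsGloballyMinimal] (C : VariableChange ℚ),
    IsFrame W p K 𝔭 W' C → W.analyticRank = 1 →
    ∀ (κ : ZpExtension K p), κ.IsAnticyclotomic →
      ∀ (γ : absoluteGaloisGroup K) [Fact (κ.IsTopGenerator γ)],
        ∃ (ι : PadicAlgCl p ≃+* ℂ) (φ : HeckeCharacter K) (Ω : ℂ) (𝓔 : AcDualExpSystem W p K 𝔭 κ ι)
          (D : EllipticUnitClassData W p K 𝔭 κ γ ι φ Ω 𝓔) (c : ℕ), D.HasBottomIndexExp c ∧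
          ∀ (n₀ : ℕ), AcSelmer.XAc.HasCharValuationAt (W.baseChange K) p κ 𝔭 ∅ γ n₀ →
            Finite {x : AcSelmer.XAc (W.baseChange K) p κ 𝔭 ∅ γ //
              (PowerSeries.X : IwasawaAlgebra p) • x = 0} →
            (n₀ : ℤ) + padicValNat p (Nat.card {x : AcSelmer.XAc (W.baseChange K) p κ 𝔭 ∅ γ //
                (PowerSeries.X : IwasawaAlgebra p) • x = 0}) = c

/-- **(R-PR)|IMC TYPED (the ATTACKED statement; NOT in print; nothing asserted): Perrin-Riou's law for the
bottom elliptic-unit class at a CM-ramified prime in analytic rank one, RELATIVE to the main-conjecture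
identity.** For a framed pair with generators of levels `n`, `n'` and `#Ш_an(W) = q`, `#Ш_an(W') = q'`
(the binders of (R-EU)), for EVERY datum `D : EllipticUnitClassData W p K 𝔭 κ γ ι φ Ω 𝓔` and every
`c` with `D.HasBottomIndexExp c` which satisfies the IMC identity `n₀ + log_p #X[T] = c` (for all `n₀`
with `ord_p f(0) = n₀`, `X[T]` finite): `c = n + n' + ord_p q + ord_p q'`. On the genuine class this is
(★_an) — what a ramified-prime explicit reciprocity / BDP-type formula proves ([BKNO] Thm. 7.2: ⟺ a
formula for `𝓛(𝟙)`; §1.4 «report elsewhere»); junk data (IMC identity false) satisfy it vacuously, so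
the statement is junk-free (ram, BETA-DESIGN §3). LABEL: CONSTRUCTION / OPEN.
HONEST T1 READING (planner D112 (b), verbatim): «Value ⟺ 19143 modulo {IMC∃, (R-tors)} ⟺ BSD₇ on 𝒞₇
modulo print (p439069/p431947); the split is a BRIDGE split of 19143 with T = IMC∃ SUBSTANTIVE-in-print
(human BC2 ruling: «T must not give S alone AND T must be substantive»; both hold: probe IMC∃ → leaf
fails, IMC is Rubin 1991 + BKNO 2026), seam trivial by design (`trivial_seam` flag declared, not
hidden); it RELOCATES the open content (the ramified value formula (★_an)) onto one correctly-labelled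
item, it does not weaken it; K7r's disposition may stay FRONTIER — that is the tribunal's call, not
claimed here.» BRIDGE split, T = (R-IMC)∃. In the kernel: `ramifiedCMBottomClassIndexLawAt_of_indexAt`
((R-EU) ∧ (R-tors) ⟹ this) and `ramifiedCMEllipticUnitIndexAt_of_imc_of_indexLaw` ((R-IMC)∃ ∧ this ⟹
(R-EU)); with `…Theorems.RamifiedSevenEllipticUnits.ramifiedCMEllipticUnitIndexAt_iff_bsdp` (p439069)
this ⟺ `BSDp W p` modulo {(R-IMC)∃, GZK, modularity, GZ I.(7.3), Cassels} at every CM-ramified prime.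
[cite: BurungaleKobayashiNakamuraOta2026, Thm. 7.2 and §1.4 (arXiv:2608.06879 pp. 8, 41) (claim; preprint; shape only)]
[cite: GrossZagier1986, Thm. I.(7.3) (rationality of #Ш_an)] -/
@[conjecture] def RamifiedCMBottomClassIndexLawAt : Prop :=
  ∀ (K : Type) [Field K] [NumberField K] (𝔭 : HeightOneSpectrum (𝓞 K))
    (W' : WeierstrassCurve ℚ) [W'.IsElliptic] [W'.IsGloballyMinimal] (C : VariableChange ℚ),
    IsFrame W p K 𝔭 W' C → W.analyticRank = 1 →
    ∀ (κ : ZpExtension K p), κ.IsAnticyclotomic →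
      ∀ (γ : absoluteGaloisGroup K) [Fact (κ.IsTopGenerator γ)]
        (P : W.toAffine.Point) (n : ℕ) (P' : W'.toAffine.Point) (n' : ℕ),
        ¬ IsOfFinAddOrder P →
        (∀ R : W.toAffine.Point, ∃ (k : ℤ) (T : W.toAffine.Point), IsOfFinAddOrder T ∧ R = k • P + T) →
        (∀ Q : (W.baseChange ℚ_[p]).toAffine.Point, p • Q = 0 → Q = 0) →
        (∃ Q : (W.baseChange ℚ_[p]).toAffine.Point, p ^ n • Q = W.toPadicPoint p P) →
        (∀ Q : (W.baseChange ℚ_[p]).toAffine.Point, p ^ (n + 1) • Q ≠ W.toPadicPoint p P) →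
        ¬ IsOfFinAddOrder P' →
        (∀ R : W'.toAffine.Point, ∃ (k : ℤ) (T : W'.toAffine.Point),
          IsOfFinAddOrder T ∧ R = k • P' + T) →
        (∀ Q : (W'.baseChange ℚ_[p]).toAffine.Point, p • Q = 0 → Q = 0) →
        (∃ Q : (W'.baseChange ℚ_[p]).toAffine.Point, p ^ n' • Q = W'.toPadicPoint p P') →
        (∀ Q : (W'.baseChange ℚ_[p]).toAffine.Point, p ^ (n' + 1) • Q ≠ W'.toPadicPoint p P') →
        ∀ (q q' : ℚ), shaAn W = (q : ℂ) → shaAn W' = (q' : ℂ) →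
        ∀ (ι : PadicAlgCl p ≃+* ℂ) (φ : HeckeCharacter K) (Ω : ℂ) (𝓔 : AcDualExpSystem W p K 𝔭 κ ι)
          (D : EllipticUnitClassData W p K 𝔭 κ γ ι φ Ω 𝓔) (c : ℕ), D.HasBottomIndexExp c →
          (∀ (n₀ : ℕ), AcSelmer.XAc.HasCharValuationAt (W.baseChange K) p κ 𝔭 ∅ γ n₀ →
            Finite {x : AcSelmer.XAc (W.baseChange K) p κ 𝔭 ∅ γ //
              (PowerSeries.X : IwasawaAlgebra p) • x = 0} →
            (n₀ : ℤ) + padicValNat p (Nat.card {x : AcSelmer.XAc (W.baseChange K) p κ 𝔭 ∅ γ //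
                (PowerSeries.X : IwasawaAlgebra p) • x = 0}) = c) →
          (c : ℤ) = (n : ℤ) + n' + padicValRat p q + padicValRat p q'

variable {W p}

omit [W.IsGloballyMinimal] in
/-- **(R-IMC)∃ ⟹ existence** (PROVED; the existence conjunct of the route's IMC piece is redundant but
harmless). [cite: BurungaleKobayashiNakamuraOta2026, Prop. 3.7 (arXiv:2608.06879 p. 20) (shape only)] -/
theorem ramifiedCMBottomClassExistsAt_of_imcAt (h1 : RamifiedCMEllipticUnitIMCAt W p) :
    RamifiedCMBottomClassExistsAt W p := by
  intro K _ _ 𝔭 W' _ _ C hF hr κ hκ γ _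
  obtain ⟨ι, φ, Ω, 𝓔, D, c, hc, -⟩ := h1 K 𝔭 W' C hF hr κ hκ γ
  exact ⟨ι, φ, Ω, 𝓔, D, c, hc⟩

omit [W.IsGloballyMinimal] in
/-- **(R-IMC)∃ ∧ (R-PR)|IMC ⟹ (R-EU)** (PROVED; the seam of the re-cut): take the datum and exponent `c`
provided by the IMC piece, read `n₀ + log_p #X[T] = c` from its identity and `c = n + n' + ord_p q +
ord_p q'` from the relative law. Trivial by design (BC2 «trivial_seam»): the content is in the two
hypotheses, neither of which gives (R-EU) or the leaf alone. [cite: Miller2011LMS, Def. 1.1] -/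
theorem ramifiedCMEllipticUnitIndexAt_of_imc_of_indexLaw
    (h1 : RamifiedCMEllipticUnitIMCAt W p) (h2 : RamifiedCMBottomClassIndexLawAt W p) :
    RamifiedCMEllipticUnitIndexAt W p := by
  intro K _ _ 𝔭 W' _ _ C hF hr κ hκ γ _ P n P' n' hP hgen htors hdiv hndiv hP' hgen' htors' hdiv' hndiv'
    q q' hq hq' n₀ hn₀ hfin
  obtain ⟨ι, φ, Ω, 𝓔, D, c, hc, himc⟩ := h1 K 𝔭 W' C hF hr κ hκ γ
  have e1 := himc n₀ hn₀ hfin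
  have e2 := h2 K 𝔭 W' C hF hr κ hκ γ P n P' n' hP hgen htors hdiv hndiv hP' hgen' htors' hdiv' hndiv'
    q q' hq hq' ι φ Ω 𝓔 D c hc himc
  rw [e1, e2]

omit [W.IsGloballyMinimal] in
/-- The same seam with the existence conjunct displayed (the shape of the route's IMC support item
`ExistsAt ∧ IMCAt`; the first argument is implied by the second and not used). [cite: Miller2011LMS, Def. 1.1] -/
theorem ramifiedCMEllipticUnitIndexAt_of_exists_of_imc_of_indexLaw
    (_hex : RamifiedCMBottomClassExistsAt W p) (h1 : RamifiedCMEllipticUnitIMCAt W p)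
    (h2 : RamifiedCMBottomClassIndexLawAt W p) : RamifiedCMEllipticUnitIndexAt W p :=
  ramifiedCMEllipticUnitIndexAt_of_imc_of_indexLaw h1 h2

omit [W.IsGloballyMinimal] in
/-- **(R-EU) ∧ (R-tors) ⟹ (R-PR)|IMC** (PROVED; the converse seam): given a datum with exponent `c` and
its IMC identity, (R-tors) supplies `n₀` and the finiteness of `X[T]`, the IMC identity gives
`n₀ + log_p #X[T] = c`, and (R-EU) gives `n₀ + log_p #X[T] = n + n' + ord_p q + ord_p q'`. So, modulo
(R-tors) (a theorem under GZK), the attacked relative law is EXACTLY as strong as (R-EU): the re-cut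
relocates the content, it does not weaken it, and no IMC piece is needed in this direction.
[cite: Miller2011LMS, Def. 1.1] -/
theorem ramifiedCMBottomClassIndexLawAt_of_indexAt (h3 : RamifiedCMEllipticUnitIndexAt W p)
    (htors : RamifiedCMStrictTorsionAt W p) : RamifiedCMBottomClassIndexLawAt W p := by
  intro K _ _ 𝔭 W' _ _ C hF hr κ hκ γ _ P n P' n' hP hgen htor hdiv hndiv hP' hgen' htor' hdiv' hndiv'
    q q' hq hq' ι φ Ω 𝓔 D c hc himc
  obtain ⟨⟨n₀, hn₀⟩, hfin⟩ := htors K 𝔭 W' C hF hr κ hκ γ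
  have e1 := himc n₀ hn₀ hfin
  have e3 := h3 K 𝔭 W' C hF hr κ hκ γ P n P' n' hP hgen htor hdiv hndiv hP' hgen' htor' hdiv' hndiv'
    q q' hq hq' n₀ hn₀ hfin
  rw [← e1, e3]

end EllipticUnitMechanism

end Summit.BirchSwinnertonDyer.Rank1Residual.X12.O11

end
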